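import Summits.NavierStokesRegularity.NavierStokesRegularity.Theorems.EulerZoomLiouvillePowerGaugeEulerLiouvilleEnergySaturationMember

/-!
# Energy saturation on rung C1 of the crux `EulerZoomLiouville.PowerGaugeEulerLiouville`, IX:
# the two-sided energy law of the surviving self-similar candidates (census form)
# (crux = stmt-NavierStokesRegularity-19832, route №10 `EulerZoomLiouville`, line `birth`)

Seat `ns-ezl-19832-w2` (stub-worker under the crux lead `ns-ezl-19832-p1`), cell ns-regularity-ideate.

CENSUS FORM of the energy-saturation stratum (files I–VIII).  For an exactly self-similar member of
Seregin's power-gauged ancient Euler class (crux hypotheses verbatim, `0 < ρ < 1`, profile `(V, P)`,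
`γ = 1/(2+ρ)`):

* `selfSimilar_energy_dichotomy` — **DICHOTOMY**: either the member vanishes a.e. on the slab, or its
  profile energy is TWO-SIDED EXTREMAL,
  `c₁ L^{1−2ρ} ≤ ∫_{B_L}|V|² ≤ c L^{1−2ρ}` for all large `L` with `c₁ > 0`
  (lower bound: `selfSimilar_ae_eq_zero_of_subExtremal`; upper bound: the `A`-gauge,
  `profile_energy_growth_of_gaugeA`).  This is Bronzi–Shvydkoy 2015 Thm 1.1 (1.8)
  (`∫_{|y|<L}|v|² ∼ L^{N−2α}`, arXiv:1310.8611) for WEAK `H¹_loc` profiles in the power-gauged class, every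
  `ρ ∈ (0,1)`, with the `E`-gauge in place of the printed `L^p` shell hypothesis;
* `selfSimilar_ae_eq_zero_of_normEnergy_tendsto_zero` — if for one cut-off `σ` the (convergent,
  `selfSimilar_tendsto_normEnergy`) normalised energy `L^{2ρ−1}∫σ(L⁻¹y)|V|²` tends to `0`, the member
  vanishes: the limit `N_∞(σ)` of a nontrivial candidate is strictly positive.

So the open core of the crux meets rung C1 only in EXACTLY EXTREMAL profiles: every exactly self-similar
candidate that survives carries energy `∼ L^{1−2ρ}` on large balls, neither more (gauge) nor less (this
stratum).  WHAT THIS IS NOT: not NS regularity, not the crux (stmt-19832 stays open: the generic candidate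
`|V| ∼ |y|^{−(1+ρ)}` is exactly extremal), not rung C1. `--supports` stmt-19832.
[folklore; cf. BronziShvydkoy2015 Thm 1.1]
-/

noncomputable section

set_option linter.dupNamespace false

open MeasureTheory Set Filter Topology Metric Function TopologicalSpace
open scoped ENNReal NNReal RealInnerProductSpace ContDiff Laplacian

namespace Summit.NavierStokesRegularity.NavierStokesRegularity.Theorems.PowerGaugeEulerLiouville

open Literature.Analysis Literature.Analysis.FunctionSpaces Literature.Analysis.FluidPDE

namespace EnergySaturation

/-- Real form of the `A`-growth: `∫_{B_L}|V|² ≤ c L^{1−2ρ}` (`L > 0`). [folklore] -/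
theorem setIntegral_ball_sq_le_of_growth {ρ : ℝ} {V : EuclideanSpace ℝ (Fin 3) → EuclideanSpace ℝ (Fin 3)}
    (hVm : AEStronglyMeasurable V volume) {c : ℝ≥0}
    (hA : ∀ L : ℝ, 0 < L → ∫⁻ y in ball (0 : EuclideanSpace ℝ (Fin 3)) L, ‖V y‖ₑ ^ 2 ≤
      (c : ℝ≥0∞) * ENNReal.ofReal (L ^ (1 - 2 * ρ))) {L : ℝ} (hL : 0 < L) :
    ∫ y in ball (0 : EuclideanSpace ℝ (Fin 3)) L, ‖V y‖ ^ 2 ≤ c * L ^ (1 - 2 * ρ) := by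
  have hV2B : IntegrableOn (fun y => ‖V y‖ ^ 2) (ball (0 : EuclideanSpace ℝ (Fin 3)) L) volume :=
    (memLp_two_iff_integrable_sq_norm hVm.restrict).1 (memLp_two_ball_of_growth hVm hA hL)
  rw [integral_eq_lintegral_of_nonneg_ae (Eventually.of_forall fun y => sq_nonneg _) hV2B.aestronglyMeasurable]
  have e : ∫⁻ y in ball (0 : EuclideanSpace ℝ (Fin 3)) L, ENNReal.ofReal (‖V y‖ ^ 2) =
      ∫⁻ y in ball (0 : EuclideanSpace ℝ (Fin 3)) L, ‖V y‖ₑ ^ 2 :=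
    lintegral_congr fun y => by rw [← ofReal_norm, ENNReal.ofReal_pow (norm_nonneg _)]
  rw [e]
  have hfin : (c : ℝ≥0∞) * ENNReal.ofReal (L ^ (1 - 2 * ρ)) ≠ ⊤ :=
    ENNReal.mul_ne_top ENNReal.coe_ne_top ENNReal.ofReal_ne_top
  calc (∫⁻ y in ball (0 : EuclideanSpace ℝ (Fin 3)) L, ‖V y‖ₑ ^ 2).toReal
      ≤ ((c : ℝ≥0∞) * ENNReal.ofReal (L ^ (1 - 2 * ρ))).toReal := ENNReal.toReal_mono hfin (hA L hL)
    _ = c * L ^ (1 - 2 * ρ) := by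
        rw [ENNReal.toReal_mul, ENNReal.coe_toReal, ENNReal.toReal_ofReal (by positivity)]

/-- **THE TWO-SIDED ENERGY LAW (dichotomy form).**  An exactly self-similar member of the power-gauged
ancient Euler class (crux hypotheses verbatim, `0 < ρ < 1`) either VANISHES a.e. on the slab, or its profile
energy is two-sided extremal: there are `c₁ > 0` and `L₀` with
`c₁ L^{1−2ρ} ≤ ∫_{B_L}|V|² ≤ c L^{1−2ρ}` for all `L ≥ L₀` — Bronzi–Shvydkoy 2015 Thm 1.1 (1.8) in Seregin's
weak class. [folklore; cf. BronziShvydkoy2015 Thm 1.1] -/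
theorem selfSimilar_energy_dichotomy {ρ : ℝ} (hρ : 0 < ρ) (hρ1 : ρ < 1)
    {u : ℝ → EuclideanSpace ℝ (Fin 3) → EuclideanSpace ℝ (Fin 3)} {p : ℝ → EuclideanSpace ℝ (Fin 3) → ℝ}
    {H : ℝ → EuclideanSpace ℝ (Fin 3) → EuclideanSpace ℝ (Fin 3) →L[ℝ] EuclideanSpace ℝ (Fin 3)} {c : ℝ≥0}
    (hsw : IsSuitableWeakSolutionOn (slab (EuclideanSpace ℝ (Fin 3)) (Iio 0) isOpen_Iio) 0 0 u p)
    (hH : HasWeakSpatialGradientOn (slab (EuclideanSpace ℝ (Fin 3)) (Iio 0) isOpen_Iio) u H)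
    (hgauge : ∀ a : ℝ, 0 < a →
      ENNReal.ofReal (a ^ (2 * ρ)) * cknA a (0 : ℝ × EuclideanSpace ℝ (Fin 3)) u +
          ENNReal.ofReal (a ^ ρ) * cknE a (0 : ℝ × EuclideanSpace ℝ (Fin 3)) H +
        ENNReal.ofReal (a ^ (2 * ρ)) * cknD a (0 : ℝ × EuclideanSpace ℝ (Fin 3)) p ≤ (c : ℝ≥0∞))
    {V : EuclideanSpace ℝ (Fin 3) → EuclideanSpace ℝ (Fin 3)} {P : EuclideanSpace ℝ (Fin 3) → ℝ}
    (hu : ∀ τ : ℝ, τ < 0 → u τ = selfSimilarCollapse (1 / (2 + ρ)) 0 V τ)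
    (hp : ∀ τ : ℝ, τ < 0 → p τ = selfSimilarCollapsePressure (1 / (2 + ρ)) 0 P τ) :
    uncurry u =ᵐ[volume.restrict (Iio (0 : ℝ) ×ˢ (univ : Set (EuclideanSpace ℝ (Fin 3))))] 0 ∨
      ∃ c₁ : ℝ, 0 < c₁ ∧ ∃ L₀ : ℝ, ∀ L : ℝ, L₀ ≤ L →
        c₁ * L ^ (1 - 2 * ρ) ≤ ∫ y in ball (0 : EuclideanSpace ℝ (Fin 3)) L, ‖V y‖ ^ 2 ∧
          ∫ y in ball (0 : EuclideanSpace ℝ (Fin 3)) L, ‖V y‖ ^ 2 ≤ c * L ^ (1 - 2 * ρ) := by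
  obtain ⟨G, -, hVm, -, -, -, hA, -⟩ := profileData_of_selfSimilar hρ hρ1 hsw hH hgauge hu hp
  by_cases hsub : ∀ ε : ℝ, 0 < ε → ∀ L₀ : ℝ, ∃ L : ℝ, L₀ ≤ L ∧
      L ^ (2 * ρ - 1) * ∫ y in ball (0 : EuclideanSpace ℝ (Fin 3)) L, ‖V y‖ ^ 2 < ε
  · exact Or.inl (selfSimilar_ae_eq_zero_of_subExtremal hρ hρ1 hsw hH hgauge hu hp hsub)
  · right
    push Not at hsub
    obtain ⟨ε, hε, L₀, hL₀⟩ := hsub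
    refine ⟨ε, hε, max L₀ 1, fun L hL => ?_⟩
    have hL1 : 1 ≤ L := (le_max_right _ _).trans hL
    have hL0 : 0 < L := lt_of_lt_of_le one_pos hL1
    have h := hL₀ L ((le_max_left _ _).trans hL)
    refine ⟨?_, setIntegral_ball_sq_le_of_growth hVm hA hL0⟩
    -- multiply `ε ≤ L^{2ρ−1} ∫_{B_L}|V|²` by `L^{1−2ρ}`
    have hRR : L ^ (1 - 2 * ρ) * L ^ (2 * ρ - 1) = 1 := by rw [← Real.rpow_add hL0]; norm_num
    calc ε * L ^ (1 - 2 * ρ) ≤ (L ^ (2 * ρ - 1) * ∫ y in ball (0 : EuclideanSpace ℝ (Fin 3)) L, ‖V y‖ ^ 2) *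
          L ^ (1 - 2 * ρ) := mul_le_mul_of_nonneg_right h (Real.rpow_nonneg hL0.le _)
      _ = (L ^ (1 - 2 * ρ) * L ^ (2 * ρ - 1)) * ∫ y in ball (0 : EuclideanSpace ℝ (Fin 3)) L, ‖V y‖ ^ 2 := by
          ring
      _ = ∫ y in ball (0 : EuclideanSpace ℝ (Fin 3)) L, ‖V y‖ ^ 2 := by rw [hRR, one_mul]

/-- **A vanishing limit of the normalised energy forces triviality.**  If for one cut-off `σ` (`0 ≤ σ`,
`σ = 1` on `B̄₁`) the normalised energy `L^{2ρ−1}∫σ(L⁻¹y)|V|²` of the profile of an exactly self-similar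
member tends to `0` as `L → ∞`, the member vanishes a.e. on the slab (`L^{2ρ−1}∫_{B_L}|V|²` is below it);
so the limit `N_∞(σ)` of `selfSimilar_tendsto_normEnergy` is positive for every nontrivial candidate.
[folklore; cf. BronziShvydkoy2015 Rem 1.2] -/
theorem selfSimilar_ae_eq_zero_of_normEnergy_tendsto_zero {ρ : ℝ} (hρ : 0 < ρ) (hρ1 : ρ < 1)
    {u : ℝ → EuclideanSpace ℝ (Fin 3) → EuclideanSpace ℝ (Fin 3)} {p : ℝ → EuclideanSpace ℝ (Fin 3) → ℝ}
    {H : ℝ → EuclideanSpace ℝ (Fin 3) → EuclideanSpace ℝ (Fin 3) →L[ℝ] EuclideanSpace ℝ (Fin 3)} {c : ℝ≥0}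
    (hsw : IsSuitableWeakSolutionOn (slab (EuclideanSpace ℝ (Fin 3)) (Iio 0) isOpen_Iio) 0 0 u p)
    (hH : HasWeakSpatialGradientOn (slab (EuclideanSpace ℝ (Fin 3)) (Iio 0) isOpen_Iio) u H)
    (hgauge : ∀ a : ℝ, 0 < a →
      ENNReal.ofReal (a ^ (2 * ρ)) * cknA a (0 : ℝ × EuclideanSpace ℝ (Fin 3)) u +
          ENNReal.ofReal (a ^ ρ) * cknE a (0 : ℝ × EuclideanSpace ℝ (Fin 3)) H +
        ENNReal.ofReal (a ^ (2 * ρ)) * cknD a (0 : ℝ × EuclideanSpace ℝ (Fin 3)) p ≤ (c : ℝ≥0∞))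
    {V : EuclideanSpace ℝ (Fin 3) → EuclideanSpace ℝ (Fin 3)} {P : EuclideanSpace ℝ (Fin 3) → ℝ}
    (hu : ∀ τ : ℝ, τ < 0 → u τ = selfSimilarCollapse (1 / (2 + ρ)) 0 V τ)
    (hp : ∀ τ : ℝ, τ < 0 → p τ = selfSimilarCollapsePressure (1 / (2 + ρ)) 0 P τ)
    {σ : EuclideanSpace ℝ (Fin 3) → ℝ} (hσc : Continuous σ) (hσs : HasCompactSupport σ)
    (h0 : ∀ z, 0 ≤ σ z) (hone : ∀ z, ‖z‖ ≤ 1 → σ z = 1)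
    (hlim : Tendsto (fun L : ℝ => L ^ (2 * ρ - 1) * ∫ y, σ (L⁻¹ • y) * ‖V y‖ ^ 2) atTop (𝓝 0)) :
    uncurry u =ᵐ[volume.restrict (Iio (0 : ℝ) ×ˢ (univ : Set (EuclideanSpace ℝ (Fin 3))))] 0 := by
  obtain ⟨G, -, hVm, -, -, -, hA, -⟩ := profileData_of_selfSimilar hρ hρ1 hsw hH hgauge hu hp
  have hV2 : LocallyIntegrable (fun y => ‖V y‖ ^ 2) volume := locallyIntegrable_norm_sq_of_growth hVm hA
  refine selfSimilar_ae_eq_zero_of_subExtremal hρ hρ1 hsw hH hgauge hu hp fun ε hε L₀ => ?_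
  obtain ⟨L, hLε, hLge⟩ := ((hlim.eventually (gt_mem_nhds hε)).and (eventually_ge_atTop (max L₀ 1))).exists
  have hL0 : 0 < L := lt_of_lt_of_le one_pos ((le_max_right _ _).trans hLge)
  refine ⟨L, (le_max_left _ _).trans hLge, lt_of_le_of_lt ?_ hLε⟩
  -- `∫_{B_L}|V|² ≤ ∫ σ(L⁻¹y)|V|²`
  have hint : Integrable (fun y => σ (L⁻¹ • y) * ‖V y‖ ^ 2) volume := by
    have hcont : Continuous (fun y : EuclideanSpace ℝ (Fin 3) => σ (L⁻¹ • y)) :=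
      hσc.comp (continuous_const_smul _)
    have := hV2.integrable_smul_left_of_hasCompactSupport hcont (hσs.comp_smul (inv_ne_zero hL0.ne'))
    simpa only [smul_eq_mul] using this
  have hV2B : IntegrableOn (fun y => ‖V y‖ ^ 2) (ball (0 : EuclideanSpace ℝ (Fin 3)) L) volume :=
    (memLp_two_iff_integrable_sq_norm hVm.restrict).1 (memLp_two_ball_of_growth hVm hA hL0)
  have hle : ∫ y in ball (0 : EuclideanSpace ℝ (Fin 3)) L, ‖V y‖ ^ 2 ≤ ∫ y, σ (L⁻¹ • y) * ‖V y‖ ^ 2 := by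
    rw [← integral_indicator measurableSet_ball]
    refine integral_mono (hV2B.integrable_indicator measurableSet_ball) hint fun y => ?_
    by_cases hy : y ∈ ball (0 : EuclideanSpace ℝ (Fin 3)) L
    · rw [indicator_of_mem hy]
      rw [mem_ball, dist_zero_right] at hy
      have h1 : σ (L⁻¹ • y) = 1 := by
        apply hone
        rw [norm_smul, norm_inv, Real.norm_of_nonneg hL0.le, inv_mul_le_iff₀ hL0]
        linarith
      rw [h1, one_mul]
    · rw [indicator_of_notMem hy]
      exact mul_nonneg (h0 _) (sq_nonneg _)
  exact mul_le_mul_of_nonneg_left hle (Real.rpow_nonneg hL0.le _)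


/-- **The `liminf` spelling.**  An exactly self-similar member of the power-gauged ancient Euler class
(crux hypotheses verbatim, `0 < ρ < 1`) whose profile has
`liminf_{L→∞} L^{2ρ−1}∫_{B_L}|V|² = 0` (Mathlib `Filter.liminf … atTop = 0`; the quantity lies in `[0, c]`
by the `A`-gauge, so the `liminf` is the honest one) vanishes a.e. on the slab — the same theorem as
`selfSimilar_ae_eq_zero_of_subExtremal`, in the binder shape the crux lead registers as the stub
`selfSimilarSubExtremal` of skeleton v9. [folklore; cf. BronziShvydkoy2015 Thm 1.1] -/
theorem selfSimilar_ae_eq_zero_of_liminf_eq_zero {ρ : ℝ} (hρ : 0 < ρ) (hρ1 : ρ < 1)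
    {u : ℝ → EuclideanSpace ℝ (Fin 3) → EuclideanSpace ℝ (Fin 3)} {p : ℝ → EuclideanSpace ℝ (Fin 3) → ℝ}
    {H : ℝ → EuclideanSpace ℝ (Fin 3) → EuclideanSpace ℝ (Fin 3) →L[ℝ] EuclideanSpace ℝ (Fin 3)} {c : ℝ≥0}
    (hsw : IsSuitableWeakSolutionOn (slab (EuclideanSpace ℝ (Fin 3)) (Iio 0) isOpen_Iio) 0 0 u p)
    (hH : HasWeakSpatialGradientOn (slab (EuclideanSpace ℝ (Fin 3)) (Iio 0) isOpen_Iio) u H)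
    (hgauge : ∀ a : ℝ, 0 < a →
      ENNReal.ofReal (a ^ (2 * ρ)) * cknA a (0 : ℝ × EuclideanSpace ℝ (Fin 3)) u +
          ENNReal.ofReal (a ^ ρ) * cknE a (0 : ℝ × EuclideanSpace ℝ (Fin 3)) H +
        ENNReal.ofReal (a ^ (2 * ρ)) * cknD a (0 : ℝ × EuclideanSpace ℝ (Fin 3)) p ≤ (c : ℝ≥0∞))
    {V : EuclideanSpace ℝ (Fin 3) → EuclideanSpace ℝ (Fin 3)} {P : EuclideanSpace ℝ (Fin 3) → ℝ}
    (hu : ∀ τ : ℝ, τ < 0 → u τ = selfSimilarCollapse (1 / (2 + ρ)) 0 V τ)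
    (hp : ∀ τ : ℝ, τ < 0 → p τ = selfSimilarCollapsePressure (1 / (2 + ρ)) 0 P τ)
    (hlim : Filter.liminf (fun L : ℝ => L ^ (2 * ρ - 1) *
      ∫ x in Metric.ball (0 : EuclideanSpace ℝ (Fin 3)) L, ‖V x‖ ^ 2) Filter.atTop = 0) :
    Function.uncurry u =ᵐ[volume.restrict (Iio (0 : ℝ) ×ˢ (univ : Set (EuclideanSpace ℝ (Fin 3))))] 0 := by
  obtain ⟨G, -, hVm, -, -, -, hA, -⟩ := profileData_of_selfSimilar hρ hρ1 hsw hH hgauge hu hp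
  refine selfSimilar_ae_eq_zero_of_subExtremal hρ hρ1 hsw hH hgauge hu hp fun ε hε L₀ => ?_
  -- the normalised ball energy is eventually `≤ c`, hence cobounded from below; `liminf < ε` gives frequency
  have hbdd : ∀ᶠ L : ℝ in atTop, L ^ (2 * ρ - 1) *
      ∫ x in Metric.ball (0 : EuclideanSpace ℝ (Fin 3)) L, ‖V x‖ ^ 2 ≤ (c : ℝ) := by
    filter_upwards [eventually_gt_atTop (0 : ℝ)] with L hL
    have h := setIntegral_ball_sq_le_of_growth hVm hA hL
    have hRR : L ^ (2 * ρ - 1) * L ^ (1 - 2 * ρ) = 1 := by rw [← Real.rpow_add hL]; norm_num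
    calc L ^ (2 * ρ - 1) * ∫ x in Metric.ball (0 : EuclideanSpace ℝ (Fin 3)) L, ‖V x‖ ^ 2
        ≤ L ^ (2 * ρ - 1) * (c * L ^ (1 - 2 * ρ)) := mul_le_mul_of_nonneg_left h (Real.rpow_nonneg hL.le _)
      _ = c * (L ^ (2 * ρ - 1) * L ^ (1 - 2 * ρ)) := by ring
      _ = c := by rw [hRR, mul_one]
  have hco : Filter.IsCoboundedUnder (· ≥ ·) atTop (fun L : ℝ => L ^ (2 * ρ - 1) *
      ∫ x in Metric.ball (0 : EuclideanSpace ℝ (Fin 3)) L, ‖V x‖ ^ 2) :=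
    Filter.isCoboundedUnder_ge_of_eventually_le atTop hbdd
  have hfreq := Filter.frequently_lt_of_liminf_lt hco (by rw [hlim]; exact hε)
  obtain ⟨L, hL, hlt⟩ := (Filter.frequently_atTop.1 hfreq) L₀
  exact ⟨L, hL, hlt⟩

end EnergySaturation

end Summit.NavierStokesRegularity.NavierStokesRegularity.Theorems.PowerGaugeEulerLiouville

end
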